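import Summits.Ventures.FusionMHD.Bench.SAlphaEnclosureChecks2
import HarnessLib

/-!
# F3 — `s–α` at `(s, α) = (1, 2/5)`: even-solution enclosure transcript, KERNEL CHECK FILE 3/3 (stages 34–50: HOE step test ∧ landing,
# one `decide` per stage, ≈ 5 kernel-s each)
(venture LADDER-GRIDFUSION, rung F3, «#199-cand … PATH W» of gridfusion-lead RULING 9ez (6): «lit-3 socket `not_unstableWitness_of_clockField` +
enclosure + a gridfusion `EChainCert` `check = true` in kernel»; cell `gridfusion`, typed by gridfusion-lit-3 (g13), 2026-08-28; generator =
lit-3's untrusted Lean-interpreter search `scratch/GenSAlphaChain51g.lean` (Taylor tube + padding `2·10⁻²`, a-priori grid `10⁻⁴`, hand-over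
grid `10⁻⁷`); 0 `def … : Prop` facts, 0 kit jobs, no `native_decide`, no floating point.)

-/

open NonemptyInterval
open Literature.Analysis.ODE Literature.Analysis.ValidatedNumerics Literature.Analysis.ValidatedNumerics.ITaylor

namespace Summit.Ventures.FusionMHD.Bench.SAlphaEnclosure

/-- Stage 34: the elementary HOE step test (derived program over `W_34` and `S_34`, inclusion (8.10) ⊆ `S_34`) AND the landing of its
end box in the hand-over box of stage 35 — ONE kernel evaluation. [cite: Moore1979, §8.1 eq. (8.10) with (8.13)] [cite: NedialkovJacksonCorliss1999, §5 Algorithm I] -/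
theorem ok34 : ((st34.toECert sAlphaCode cfg).check && boxLE (st34.toECert sAlphaCode cfg).endBox st35.init) = true := by
  decide +kernel

/-- Stage 34 passes the step test. [cite: Moore1979, §8.1 eq. (8.10) with (8.13)] -/
theorem ok34c : (st34.toECert sAlphaCode cfg).check = true := (Bool.and_eq_true_iff.1 ok34).1

/-- The end box of stage 34 lands in the hand-over box of stage 35. [cite: NedialkovJacksonCorliss1999, §5 Algorithm I] -/
theorem ok34b : boxLE (st34.toECert sAlphaCode cfg).endBox st35.init = true := (Bool.and_eq_true_iff.1 ok34).2

/-- Stage 35: the elementary HOE step test (derived program over `W_35` and `S_35`, inclusion (8.10) ⊆ `S_35`) AND the landing of its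
end box in the hand-over box of stage 36 — ONE kernel evaluation. [cite: Moore1979, §8.1 eq. (8.10) with (8.13)] [cite: NedialkovJacksonCorliss1999, §5 Algorithm I] -/
theorem ok35 : ((st35.toECert sAlphaCode cfg).check && boxLE (st35.toECert sAlphaCode cfg).endBox st36.init) = true := by
  decide +kernel

/-- Stage 35 passes the step test. [cite: Moore1979, §8.1 eq. (8.10) with (8.13)] -/
theorem ok35c : (st35.toECert sAlphaCode cfg).check = true := (Bool.and_eq_true_iff.1 ok35).1

/-- The end box of stage 35 lands in the hand-over box of stage 36. [cite: NedialkovJacksonCorliss1999, §5 Algorithm I] -/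
theorem ok35b : boxLE (st35.toECert sAlphaCode cfg).endBox st36.init = true := (Bool.and_eq_true_iff.1 ok35).2

/-- Stage 36: the elementary HOE step test (derived program over `W_36` and `S_36`, inclusion (8.10) ⊆ `S_36`) AND the landing of its
end box in the hand-over box of stage 37 — ONE kernel evaluation. [cite: Moore1979, §8.1 eq. (8.10) with (8.13)] [cite: NedialkovJacksonCorliss1999, §5 Algorithm I] -/
theorem ok36 : ((st36.toECert sAlphaCode cfg).check && boxLE (st36.toECert sAlphaCode cfg).endBox st37.init) = true := by
  decide +kernel

/-- Stage 36 passes the step test. [cite: Moore1979, §8.1 eq. (8.10) with (8.13)] -/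
theorem ok36c : (st36.toECert sAlphaCode cfg).check = true := (Bool.and_eq_true_iff.1 ok36).1

/-- The end box of stage 36 lands in the hand-over box of stage 37. [cite: NedialkovJacksonCorliss1999, §5 Algorithm I] -/
theorem ok36b : boxLE (st36.toECert sAlphaCode cfg).endBox st37.init = true := (Bool.and_eq_true_iff.1 ok36).2

/-- Stage 37: the elementary HOE step test (derived program over `W_37` and `S_37`, inclusion (8.10) ⊆ `S_37`) AND the landing of its
end box in the hand-over box of stage 38 — ONE kernel evaluation. [cite: Moore1979, §8.1 eq. (8.10) with (8.13)] [cite: NedialkovJacksonCorliss1999, §5 Algorithm I] -/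
theorem ok37 : ((st37.toECert sAlphaCode cfg).check && boxLE (st37.toECert sAlphaCode cfg).endBox st38.init) = true := by
  decide +kernel

/-- Stage 37 passes the step test. [cite: Moore1979, §8.1 eq. (8.10) with (8.13)] -/
theorem ok37c : (st37.toECert sAlphaCode cfg).check = true := (Bool.and_eq_true_iff.1 ok37).1

/-- The end box of stage 37 lands in the hand-over box of stage 38. [cite: NedialkovJacksonCorliss1999, §5 Algorithm I] -/
theorem ok37b : boxLE (st37.toECert sAlphaCode cfg).endBox st38.init = true := (Bool.and_eq_true_iff.1 ok37).2

/-- Stage 38: the elementary HOE step test (derived program over `W_38` and `S_38`, inclusion (8.10) ⊆ `S_38`) AND the landing of its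
end box in the hand-over box of stage 39 — ONE kernel evaluation. [cite: Moore1979, §8.1 eq. (8.10) with (8.13)] [cite: NedialkovJacksonCorliss1999, §5 Algorithm I] -/
theorem ok38 : ((st38.toECert sAlphaCode cfg).check && boxLE (st38.toECert sAlphaCode cfg).endBox st39.init) = true := by
  decide +kernel

/-- Stage 38 passes the step test. [cite: Moore1979, §8.1 eq. (8.10) with (8.13)] -/
theorem ok38c : (st38.toECert sAlphaCode cfg).check = true := (Bool.and_eq_true_iff.1 ok38).1

/-- The end box of stage 38 lands in the hand-over box of stage 39. [cite: NedialkovJacksonCorliss1999, §5 Algorithm I] -/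
theorem ok38b : boxLE (st38.toECert sAlphaCode cfg).endBox st39.init = true := (Bool.and_eq_true_iff.1 ok38).2

/-- Stage 39: the elementary HOE step test (derived program over `W_39` and `S_39`, inclusion (8.10) ⊆ `S_39`) AND the landing of its
end box in the hand-over box of stage 40 — ONE kernel evaluation. [cite: Moore1979, §8.1 eq. (8.10) with (8.13)] [cite: NedialkovJacksonCorliss1999, §5 Algorithm I] -/
theorem ok39 : ((st39.toECert sAlphaCode cfg).check && boxLE (st39.toECert sAlphaCode cfg).endBox st40.init) = true := by
  decide +kernel

/-- Stage 39 passes the step test. [cite: Moore1979, §8.1 eq. (8.10) with (8.13)] -/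
theorem ok39c : (st39.toECert sAlphaCode cfg).check = true := (Bool.and_eq_true_iff.1 ok39).1

/-- The end box of stage 39 lands in the hand-over box of stage 40. [cite: NedialkovJacksonCorliss1999, §5 Algorithm I] -/
theorem ok39b : boxLE (st39.toECert sAlphaCode cfg).endBox st40.init = true := (Bool.and_eq_true_iff.1 ok39).2

/-- Stage 40: the elementary HOE step test (derived program over `W_40` and `S_40`, inclusion (8.10) ⊆ `S_40`) AND the landing of its
end box in the hand-over box of stage 41 — ONE kernel evaluation. [cite: Moore1979, §8.1 eq. (8.10) with (8.13)] [cite: NedialkovJacksonCorliss1999, §5 Algorithm I] -/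
theorem ok40 : ((st40.toECert sAlphaCode cfg).check && boxLE (st40.toECert sAlphaCode cfg).endBox st41.init) = true := by
  decide +kernel

/-- Stage 40 passes the step test. [cite: Moore1979, §8.1 eq. (8.10) with (8.13)] -/
theorem ok40c : (st40.toECert sAlphaCode cfg).check = true := (Bool.and_eq_true_iff.1 ok40).1

/-- The end box of stage 40 lands in the hand-over box of stage 41. [cite: NedialkovJacksonCorliss1999, §5 Algorithm I] -/
theorem ok40b : boxLE (st40.toECert sAlphaCode cfg).endBox st41.init = true := (Bool.and_eq_true_iff.1 ok40).2

/-- Stage 41: the elementary HOE step test (derived program over `W_41` and `S_41`, inclusion (8.10) ⊆ `S_41`) AND the landing of its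
end box in the hand-over box of stage 42 — ONE kernel evaluation. [cite: Moore1979, §8.1 eq. (8.10) with (8.13)] [cite: NedialkovJacksonCorliss1999, §5 Algorithm I] -/
theorem ok41 : ((st41.toECert sAlphaCode cfg).check && boxLE (st41.toECert sAlphaCode cfg).endBox st42.init) = true := by
  decide +kernel

/-- Stage 41 passes the step test. [cite: Moore1979, §8.1 eq. (8.10) with (8.13)] -/
theorem ok41c : (st41.toECert sAlphaCode cfg).check = true := (Bool.and_eq_true_iff.1 ok41).1

/-- The end box of stage 41 lands in the hand-over box of stage 42. [cite: NedialkovJacksonCorliss1999, §5 Algorithm I] -/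
theorem ok41b : boxLE (st41.toECert sAlphaCode cfg).endBox st42.init = true := (Bool.and_eq_true_iff.1 ok41).2

/-- Stage 42: the elementary HOE step test (derived program over `W_42` and `S_42`, inclusion (8.10) ⊆ `S_42`) AND the landing of its
end box in the hand-over box of stage 43 — ONE kernel evaluation. [cite: Moore1979, §8.1 eq. (8.10) with (8.13)] [cite: NedialkovJacksonCorliss1999, §5 Algorithm I] -/
theorem ok42 : ((st42.toECert sAlphaCode cfg).check && boxLE (st42.toECert sAlphaCode cfg).endBox st43.init) = true := by
  decide +kernel

/-- Stage 42 passes the step test. [cite: Moore1979, §8.1 eq. (8.10) with (8.13)] -/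
theorem ok42c : (st42.toECert sAlphaCode cfg).check = true := (Bool.and_eq_true_iff.1 ok42).1

/-- The end box of stage 42 lands in the hand-over box of stage 43. [cite: NedialkovJacksonCorliss1999, §5 Algorithm I] -/
theorem ok42b : boxLE (st42.toECert sAlphaCode cfg).endBox st43.init = true := (Bool.and_eq_true_iff.1 ok42).2

/-- Stage 43: the elementary HOE step test (derived program over `W_43` and `S_43`, inclusion (8.10) ⊆ `S_43`) AND the landing of its
end box in the hand-over box of stage 44 — ONE kernel evaluation. [cite: Moore1979, §8.1 eq. (8.10) with (8.13)] [cite: NedialkovJacksonCorliss1999, §5 Algorithm I] -/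
theorem ok43 : ((st43.toECert sAlphaCode cfg).check && boxLE (st43.toECert sAlphaCode cfg).endBox st44.init) = true := by
  decide +kernel

/-- Stage 43 passes the step test. [cite: Moore1979, §8.1 eq. (8.10) with (8.13)] -/
theorem ok43c : (st43.toECert sAlphaCode cfg).check = true := (Bool.and_eq_true_iff.1 ok43).1

/-- The end box of stage 43 lands in the hand-over box of stage 44. [cite: NedialkovJacksonCorliss1999, §5 Algorithm I] -/
theorem ok43b : boxLE (st43.toECert sAlphaCode cfg).endBox st44.init = true := (Bool.and_eq_true_iff.1 ok43).2

/-- Stage 44: the elementary HOE step test (derived program over `W_44` and `S_44`, inclusion (8.10) ⊆ `S_44`) AND the landing of its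
end box in the hand-over box of stage 45 — ONE kernel evaluation. [cite: Moore1979, §8.1 eq. (8.10) with (8.13)] [cite: NedialkovJacksonCorliss1999, §5 Algorithm I] -/
theorem ok44 : ((st44.toECert sAlphaCode cfg).check && boxLE (st44.toECert sAlphaCode cfg).endBox st45.init) = true := by
  decide +kernel

/-- Stage 44 passes the step test. [cite: Moore1979, §8.1 eq. (8.10) with (8.13)] -/
theorem ok44c : (st44.toECert sAlphaCode cfg).check = true := (Bool.and_eq_true_iff.1 ok44).1

/-- The end box of stage 44 lands in the hand-over box of stage 45. [cite: NedialkovJacksonCorliss1999, §5 Algorithm I] -/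
theorem ok44b : boxLE (st44.toECert sAlphaCode cfg).endBox st45.init = true := (Bool.and_eq_true_iff.1 ok44).2

/-- Stage 45: the elementary HOE step test (derived program over `W_45` and `S_45`, inclusion (8.10) ⊆ `S_45`) AND the landing of its
end box in the hand-over box of stage 46 — ONE kernel evaluation. [cite: Moore1979, §8.1 eq. (8.10) with (8.13)] [cite: NedialkovJacksonCorliss1999, §5 Algorithm I] -/
theorem ok45 : ((st45.toECert sAlphaCode cfg).check && boxLE (st45.toECert sAlphaCode cfg).endBox st46.init) = true := by
  decide +kernel

/-- Stage 45 passes the step test. [cite: Moore1979, §8.1 eq. (8.10) with (8.13)] -/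
theorem ok45c : (st45.toECert sAlphaCode cfg).check = true := (Bool.and_eq_true_iff.1 ok45).1

/-- The end box of stage 45 lands in the hand-over box of stage 46. [cite: NedialkovJacksonCorliss1999, §5 Algorithm I] -/
theorem ok45b : boxLE (st45.toECert sAlphaCode cfg).endBox st46.init = true := (Bool.and_eq_true_iff.1 ok45).2

/-- Stage 46: the elementary HOE step test (derived program over `W_46` and `S_46`, inclusion (8.10) ⊆ `S_46`) AND the landing of its
end box in the hand-over box of stage 47 — ONE kernel evaluation. [cite: Moore1979, §8.1 eq. (8.10) with (8.13)] [cite: NedialkovJacksonCorliss1999, §5 Algorithm I] -/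
theorem ok46 : ((st46.toECert sAlphaCode cfg).check && boxLE (st46.toECert sAlphaCode cfg).endBox st47.init) = true := by
  decide +kernel

/-- Stage 46 passes the step test. [cite: Moore1979, §8.1 eq. (8.10) with (8.13)] -/
theorem ok46c : (st46.toECert sAlphaCode cfg).check = true := (Bool.and_eq_true_iff.1 ok46).1

/-- The end box of stage 46 lands in the hand-over box of stage 47. [cite: NedialkovJacksonCorliss1999, §5 Algorithm I] -/
theorem ok46b : boxLE (st46.toECert sAlphaCode cfg).endBox st47.init = true := (Bool.and_eq_true_iff.1 ok46).2

/-- Stage 47: the elementary HOE step test (derived program over `W_47` and `S_47`, inclusion (8.10) ⊆ `S_47`) AND the landing of its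
end box in the hand-over box of stage 48 — ONE kernel evaluation. [cite: Moore1979, §8.1 eq. (8.10) with (8.13)] [cite: NedialkovJacksonCorliss1999, §5 Algorithm I] -/
theorem ok47 : ((st47.toECert sAlphaCode cfg).check && boxLE (st47.toECert sAlphaCode cfg).endBox st48.init) = true := by
  decide +kernel

/-- Stage 47 passes the step test. [cite: Moore1979, §8.1 eq. (8.10) with (8.13)] -/
theorem ok47c : (st47.toECert sAlphaCode cfg).check = true := (Bool.and_eq_true_iff.1 ok47).1

/-- The end box of stage 47 lands in the hand-over box of stage 48. [cite: NedialkovJacksonCorliss1999, §5 Algorithm I] -/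
theorem ok47b : boxLE (st47.toECert sAlphaCode cfg).endBox st48.init = true := (Bool.and_eq_true_iff.1 ok47).2

/-- Stage 48: the elementary HOE step test (derived program over `W_48` and `S_48`, inclusion (8.10) ⊆ `S_48`) AND the landing of its
end box in the hand-over box of stage 49 — ONE kernel evaluation. [cite: Moore1979, §8.1 eq. (8.10) with (8.13)] [cite: NedialkovJacksonCorliss1999, §5 Algorithm I] -/
theorem ok48 : ((st48.toECert sAlphaCode cfg).check && boxLE (st48.toECert sAlphaCode cfg).endBox st49.init) = true := by
  decide +kernel

/-- Stage 48 passes the step test. [cite: Moore1979, §8.1 eq. (8.10) with (8.13)] -/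
theorem ok48c : (st48.toECert sAlphaCode cfg).check = true := (Bool.and_eq_true_iff.1 ok48).1

/-- The end box of stage 48 lands in the hand-over box of stage 49. [cite: NedialkovJacksonCorliss1999, §5 Algorithm I] -/
theorem ok48b : boxLE (st48.toECert sAlphaCode cfg).endBox st49.init = true := (Bool.and_eq_true_iff.1 ok48).2

/-- Stage 49: the elementary HOE step test (derived program over `W_49` and `S_49`, inclusion (8.10) ⊆ `S_49`) AND the landing of its
end box in the hand-over box of stage 50 — ONE kernel evaluation. [cite: Moore1979, §8.1 eq. (8.10) with (8.13)] [cite: NedialkovJacksonCorliss1999, §5 Algorithm I] -/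
theorem ok49 : ((st49.toECert sAlphaCode cfg).check && boxLE (st49.toECert sAlphaCode cfg).endBox st50.init) = true := by
  decide +kernel

/-- Stage 49 passes the step test. [cite: Moore1979, §8.1 eq. (8.10) with (8.13)] -/
theorem ok49c : (st49.toECert sAlphaCode cfg).check = true := (Bool.and_eq_true_iff.1 ok49).1

/-- The end box of stage 49 lands in the hand-over box of stage 50. [cite: NedialkovJacksonCorliss1999, §5 Algorithm I] -/
theorem ok49b : boxLE (st49.toECert sAlphaCode cfg).endBox st50.init = true := (Bool.and_eq_true_iff.1 ok49).2

/-- Stage 50: the elementary HOE step test (derived program over `W_50` and `S_50`, inclusion (8.10) ⊆ `S_50`) AND the landing of its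
end box in the final box — ONE kernel evaluation. [cite: Moore1979, §8.1 eq. (8.10) with (8.13)] [cite: NedialkovJacksonCorliss1999, §5 Algorithm I] -/
theorem ok50 : ((st50.toECert sAlphaCode cfg).check && boxLE (st50.toECert sAlphaCode cfg).endBox finalBox) = true := by
  decide +kernel

/-- Stage 50 passes the step test. [cite: Moore1979, §8.1 eq. (8.10) with (8.13)] -/
theorem ok50c : (st50.toECert sAlphaCode cfg).check = true := (Bool.and_eq_true_iff.1 ok50).1

/-- The end box of stage 50 lands in the final box. [cite: NedialkovJacksonCorliss1999, §5 Algorithm I] -/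
theorem ok50b : boxLE (st50.toECert sAlphaCode cfg).endBox finalBox = true := (Bool.and_eq_true_iff.1 ok50).2

end Summit.Ventures.FusionMHD.Bench.SAlphaEnclosure
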